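import Summits.HubbardSuperconductivity.HubbardSuperconductivity.Theorems.AnisotropyChordHeatKernelRateGround
import Summits.HubbardSuperconductivity.HubbardSuperconductivity.Theorems.AnisotropyChordBipartiteClassFunction

/-!
# Route `AnisotropyChord`: E-CONV follows from heat-amplitude log-concavity — the analytic half of the
# theory seat's PORT-SPEC §71 S5, PROVED (connected graphs)

**Theorem** (`xxzSectorEnergyConvex_of_heatAmplitudeLogConcave`).  Assume the theory seat's finite-`t`
statement `XXZSectorHeatAmplitudeLogConcave` (`…EnergyConvexityDefs`: for `Δ ∈ [−1,1]`, `t ≥ 0` the heat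
amplitudes `c_W(t) = Re⟨𝟙_W, e^{−tH} 𝟙_W⟩` are log-concave in `W`; on paper a consequence of real
stability / T-INT).  Then on every finite CONNECTED graph and for `Δ ∈ [−1,1]` the lowest sector energies of
`H(Δ) = xxzHamiltonian 1 G (−1) Δ` are CONVEX along the magnetisation ladder:
`2E(M) ≤ E(M−1) + E(M+1)` whenever the three sectors are non-trivial — i.e. the conclusion of
`XXZSectorEnergyConvex` (E-CONV) for connected graphs.

Ingredients, all proved in the tree: `heatRate_sector` — by LEMMA R (`heatKernelRate_of_groundOverlap`)
with `K` = the weight-`W` sector (invariant: `xxz_mulVec_mem_weightSector`), `E = E_W` (variational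
characterisation `minEnergyOn_mul_le_re_rayleigh`), `w` = the positive Perron vector
(`xxz_sector_perron_pos`, whence `⟨w, 𝟙_W⟩ ≠ 0`), the rate of `c_W` is `E_W` and `c_W > 0`; then
`midpoint_convex_of_logConcave_rates`.  So E-CONV in Lean is now EXACTLY as conditional as the stability
layer (Borcea–Brändén facts ⇒ `XXZSectorHeatAmplitudeLogConcave`), no further analysis pending.
Theory seat `hubbard-h0-rotor-theory-1`, memo ROTOR-THEORY-6 §67, §71.  No definition is introduced.
-/

set_option linter.dupNamespace false

noncomputable section

namespace Summit.HubbardSuperconductivity.HubbardSuperconductivity.Theorems.AnisotropyChord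

open Matrix Complex Finset Filter Topology
open scoped ComplexOrder
open Literature.MathematicalPhysics.QuantumLattice Literature.Probability.LatticeModels
open Summit.HubbardSuperconductivity.HubbardSuperconductivity.Theorems.AnisotropyChord.OneMagnon

section Helpers

variable {V : Type*} [Fintype V] [DecidableEq V]

omit [DecidableEq V] in
/-- The weight of a spin-½ configuration is the number of sites with value `1`. [folklore] -/
theorem weight_eq_card_filter (σ : V → Fin 2) :
    (∑ z, (σ z : ℕ)) = (Finset.univ.filter fun x => σ x = 1).card := by
  rw [Finset.card_filter]
  exact Finset.sum_congr rfl fun z _ => fin_two_val_eq_ite _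

/-- **`H(Δ)` preserves every weight sector.** [folklore] -/
theorem xxz_mulVec_mem_weightSector (G : SimpleGraph V) [DecidableRel G.Adj] (Δ : ℝ) (W : ℕ)
    {v : (V → Fin 2) → ℂ} (hv : v ∈ spinZSector (Λ := V) 1 (((Fintype.card V * 1 : ℕ) : ℝ) / 2 - W)) :
    xxzHamiltonian 1 G (-1) Δ *ᵥ v ∈ spinZSector (Λ := V) 1 (((Fintype.card V * 1 : ℕ) : ℝ) / 2 - W) := by
  rw [LiebMattis.mem_spinZSector_weight_iff] at hv ⊢
  intro σ hσ
  rw [xxz_mulVec_apply G Δ v σ, hv σ hσ, mul_zero, zero_sub, neg_eq_zero, mul_eq_zero]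
  right
  refine Finset.sum_eq_zero fun e _ => ?_
  induction e using Sym2.ind with
  | h x y =>
    simp only [Sym2.lift_mk]
    split_ifs
    · refine hv _ ?_
      rw [show (∑ z, ((σ ∘ Equiv.swap x y) z : ℕ)) = ∑ z, (σ z : ℕ) from
        Equiv.sum_comp (Equiv.swap x y) (fun z => (σ z : ℕ))]
      exact hσ
    · rfl

/-- **The heat-kernel rate of a sector indicator is the sector energy** (connected graph, weight `W`
attained): `c_W(t) = Re⟨𝟙_W, e^{−tH} 𝟙_W⟩ > 0` for `t ≥ 0` and `−t⁻¹ log c_W(t) → E_W`. [folklore] -/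
theorem heatRate_sector (G : SimpleGraph V) [DecidableRel G.Adj] (hG : G.Connected) (Δ : ℝ) (W : ℕ)
    (hW : ∃ σ : V → Fin 2, (∑ z, (σ z : ℕ)) = W) :
    (∀ t : ℝ, 0 ≤ t → 0 < (star (fun σ : V → Fin 2 =>
        if (Finset.univ.filter fun x => σ x = 1).card = W then (1 : ℂ) else 0) ⬝ᵥ
        (NormedSpace.exp (-(t : ℂ) • xxzHamiltonian 1 G (-1) Δ)) *ᵥ
          (fun σ : V → Fin 2 => if (Finset.univ.filter fun x => σ x = 1).card = W then (1 : ℂ) else 0)).re) ∧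
    Tendsto (fun t : ℝ => -Real.log ((star (fun σ : V → Fin 2 =>
        if (Finset.univ.filter fun x => σ x = 1).card = W then (1 : ℂ) else 0) ⬝ᵥ
        (NormedSpace.exp (-(t : ℂ) • xxzHamiltonian 1 G (-1) Δ)) *ᵥ
          (fun σ : V → Fin 2 => if (Finset.univ.filter fun x => σ x = 1).card = W then (1 : ℂ) else 0)).re) / t)
      atTop (𝓝 (lowestEnergyInSector 1 (xxzHamiltonian 1 G (-1) Δ) (((Fintype.card V * 1 : ℕ) : ℝ) / 2 - W))) := by
  set H := xxzHamiltonian 1 G (-1) Δ with hHdef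
  have hH : H.IsHermitian := xxzHamiltonian_isHermitian 1 G (-1) Δ
  set K := spinZSector (Λ := V) 1 (((Fintype.card V * 1 : ℕ) : ℝ) / 2 - W) with hKdef
  set ind : (V → Fin 2) → ℂ := fun σ => if (Finset.univ.filter fun x => σ x = 1).card = W then (1 : ℂ) else 0
    with hind
  have hK : ∀ x ∈ K, H *ᵥ x ∈ K := fun x hx => xxz_mulVec_mem_weightSector G Δ W hx
  set E := lowestEnergyInSector 1 H (((Fintype.card V * 1 : ℕ) : ℝ) / 2 - W) with hEdef
  have hE : ∀ x ∈ K, E * (star x ⬝ᵥ x).re ≤ (star x ⬝ᵥ H *ᵥ x).re :=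
    fun x hx => minEnergyOn_mul_le_re_rayleigh hH K hx
  obtain ⟨w, hwK, hw0, hwnn, hwpos, hwoff, hHw, -⟩ := xxz_sector_perron_pos G hG Δ W hW
  have hindK : ind ∈ K := by
    rw [hKdef, LiebMattis.mem_spinZSector_weight_iff]
    intro σ hσ
    rw [hind]
    simp only
    rw [if_neg]
    rw [← weight_eq_card_filter]; exact hσ
  have hind_apply : ∀ σ, ind σ = if (∑ z, (σ z : ℕ)) = W then 1 else 0 := by
    intro σ; simp only [hind, weight_eq_card_filter]
  -- `⟨w, 𝟙_W⟩ ≠ 0`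
  have hwv : star w ⬝ᵥ ind ≠ 0 := by
    obtain ⟨σ₀, hσ₀⟩ := hW
    have hsum : star w ⬝ᵥ ind = ∑ σ, star (w σ) * ind σ := rfl
    have hre : (star w ⬝ᵥ ind).re = ∑ σ, (if (∑ z, (σ z : ℕ)) = W then (w σ).re else 0) := by
      rw [hsum, Complex.re_sum]
      refine Finset.sum_congr rfl fun σ _ => ?_
      rw [hind_apply]
      split_ifs with h
      · rw [mul_one, Complex.star_def, Complex.conj_re]
      · rw [mul_zero, Complex.zero_re]
    intro h0
    have h1 : (star w ⬝ᵥ ind).re = 0 := by rw [h0, Complex.zero_re]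
    rw [hre] at h1
    have hle : ∀ σ ∈ (Finset.univ : Finset (V → Fin 2)),
        0 ≤ (if (∑ z, (σ z : ℕ)) = W then (w σ).re else 0) := by
      intro σ _; split_ifs
      · exact (hwnn σ).1
      · exact le_rfl
    have h2 := (Finset.sum_eq_zero_iff_of_nonneg hle).1 h1 σ₀ (Finset.mem_univ _)
    rw [if_pos hσ₀] at h2
    exact (hwpos σ₀ hσ₀).ne' h2
  exact heatKernelRate_of_groundOverlap H hH K hK E hE w hwK hw0 hHw ind hindK hwv

/-- A non-trivial sector has the value `|V|/2 − W` for an attained weight `W`. [folklore] -/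
theorem exists_weight_of_sector_ne_bot {M : ℝ} (h : spinZSector (Λ := V) 1 M ≠ ⊥) :
    ∃ W : ℕ, (∃ σ : V → Fin 2, (∑ z, (σ z : ℕ)) = W) ∧ M = ((Fintype.card V * 1 : ℕ) : ℝ) / 2 - (W : ℝ) := by
  obtain ⟨ψ, hψ, hψ0⟩ := Submodule.exists_mem_ne_zero_of_ne_bot h
  exact exists_weight_of_mem_spinZSector hψ hψ0

end Helpers

/-- **E-CONV from heat-amplitude log-concavity** (see the module docstring): assuming
`XXZSectorHeatAmplitudeLogConcave`, on every finite connected graph and for `Δ ∈ [−1,1]`,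
`2E(M) ≤ E(M−1) + E(M+1)` whenever the three sectors are non-trivial.  Theory seat memo ROTOR-THEORY-6
§67/§71 S5 (analytic half). [folklore] -/
theorem xxzSectorEnergyConvex_of_heatAmplitudeLogConcave (hLC : XXZSectorHeatAmplitudeLogConcave)
    {V : Type} [Fintype V] [DecidableEq V] (G : SimpleGraph V) [DecidableRel G.Adj] (hG : G.Connected) {Δ : ℝ} (h1 : -1 ≤ Δ) (h2 : Δ ≤ 1)
    (M : ℝ) (hm : spinZSector (Λ := V) 1 (M - 1) ≠ ⊥) (h0 : spinZSector (Λ := V) 1 M ≠ ⊥)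
    (hp : spinZSector (Λ := V) 1 (M + 1) ≠ ⊥) :
    2 * lowestEnergyInSector 1 (xxzHamiltonian 1 G (-1) Δ) M ≤
      lowestEnergyInSector 1 (xxzHamiltonian 1 G (-1) Δ) (M - 1) +
        lowestEnergyInSector 1 (xxzHamiltonian 1 G (-1) Δ) (M + 1) := by
  -- the three weights `W + 1, W, W − 1`
  obtain ⟨W, hW, hMW⟩ := exists_weight_of_sector_ne_bot h0
  obtain ⟨Wp, hWp, hMp⟩ := exists_weight_of_sector_ne_bot hm
  obtain ⟨Wm, hWm, hMm⟩ := exists_weight_of_sector_ne_bot hp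
  have hWp' : Wp = W + 1 := by
    have : (Wp : ℝ) = W + 1 := by linarith
    exact_mod_cast this
  have hWm' : Wm + 1 = W := by
    have : (Wm : ℝ) + 1 = W := by linarith
    exact_mod_cast this
  subst hWp'
  have hW1 : 1 ≤ W := by omega
  have hWc : W + 1 ≤ Fintype.card V := by
    obtain ⟨σ, hσ⟩ := hWp
    rw [← hσ, weight_eq_card_filter]
    calc (Finset.univ.filter fun x => σ x = 1).card ≤ (Finset.univ : Finset V).card := Finset.card_filter_le _ _
      _ = Fintype.card V := Finset.card_univ
  -- the three rates
  obtain ⟨pos₁, rate₁⟩ := heatRate_sector G hG Δ W hW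
  obtain ⟨pos₀, rate₀⟩ := heatRate_sector G hG Δ (W + 1) hWp
  obtain ⟨pos₂, rate₂⟩ := heatRate_sector G hG Δ Wm hWm
  rw [hMp, hMm, hMW]
  refine midpoint_convex_of_logConcave_rates (fun t ht => ⟨pos₀ t ht.le, pos₁ t ht.le, pos₂ t ht.le⟩)
    ?_ rate₀ rate₁ rate₂
  intro t ht
  have key := hLC V G Δ h1 h2 t ht.le W hW1 hWc
  dsimp only at key
  rw [show W - 1 = Wm by omega] at key
  rw [pow_two]
  exact (mul_comm _ _).trans_le key

end Summit.HubbardSuperconductivity.HubbardSuperconductivity.Theorems.AnisotropyChord
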